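import Summits.ResolutionOfSingularities.ResolutionOfSingularities.Theorems.MarkedTransferCampaignW25FiniteRaySW
import Summits.ResolutionOfSingularities.ResolutionOfSingularities.Theorems.MarkedTransferCampaignW25SWStdExpr
import Summits.ResolutionOfSingularities.ResolutionOfSingularities.Theorems.MarkedTransferCampaignW25FiniteABRay
import HarnessLib

/-!
# Kill test K2.5 (register #44; slot W2.5 = L-47B-s3) on SW — companion: the MODEL-FREE core and the by-name
# certificate against the typer's `CampaignW25.K25Reduction` (unit res-L1-k25 = res-D-pv-021; PREREG-K25.md §B10)

[OURS · L W2.5 · K2.5] res-type-054's statement file `MarkedTransferCampaignW25FiniteABRay.lean` (p502315) types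
res-adj-2's PREREG k25 question as `CampaignW25.K25Reduction p e ℓ ε`, with «below the AB-ray» (`CampaignW25.IsBelowRay`)
read MORE GENEROUSLY than the unit's frozen MODEL B2/B3 (it also admits the same-pair triples whose third digit is `<lex`
EVERY ray member). PREREG-K25.md §B10 promised to state the answer against the typer's names as well and to report any
mismatch rather than resolve it. This file shows there is nothing to resolve: the SW obstruction needs only ONE
coefficient — the ray monomial `ω₁^{2^ℓ−2} ω₂³` (`rayMono ℓ`) must keep a non-zero coefficient in `ε′` — plus condition (i),
and NEITHER reading of `M_<` can touch that monomial for `ℓ ≥ 2` (its `ω₂`-exponent `3` is neither even nor `≡ 1 (mod 2^ℓ)`;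
res-type-054 NOTE 05:42:25Z (2)/(3) computes the same).

* §1 MODEL-FREE CORE: `exists_forced_term` — if `coeff (rayMono ℓ) ε′ ≠ 0` (`ℓ ≥ 2`) then EVERY depth-`ℓ` standard
  expression `X′` of `ε′` has the effective term `(e₂, 0, (0, 2^{ℓ−1} − 1, 1))` (digit arithmetic only);
  `not_derivOrdersBelowDepth` — if moreover `(α, β)(X′) = (e₂, 0)` (condition (i) on SW) that term is a top-block exponent
  `γ_j` with `|qγ_j| = 2^ℓ`, so `CampaignW25.DerivOrdersBelowDepth 2 1 ℓ X′` FAILS.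
* §2 On SW the typer's class cannot touch the ray monomial: `coeff_rayMono_eq_zero_of_memBelowSpan`.
* §3 BY NAME: `k25Reduction_fails_at` — for EVERY depth-`ℓ` standard expression `X` of `E = toFin εW` (`ℓ ≥ 2`) the
  `∃ ε′ X′ …` clause of `K25Reduction` at `X` is FALSE; hence `not_K25Reduction` : `¬ CampaignW25.K25Reduction 2 1 ℓ E`
  as soon as ONE standard expression of `E` of depth `ℓ` exists — which `SW.stdExprSW` (companion file
  `MarkedTransferCampaignW25SWStdExpr.lean`) constructs for every `ℓ ≥ 1`: `not_K25Reduction'` (every `ℓ ≥ 2`),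
  `not_K25Reduction_three`, `not_K25Reduction_four` are UNCONDITIONAL.

Numbers for res-adj-2 only; no verdict word; nothing here is a statement of the manuscript [Hironaka2017]
(lit key `paper:url-3343fd9e678b`, «under review», D-0012/D-0089). AI-written; weaker than expert review.
References: H. Hironaka, ms. 2017-03-23, Eq. (76)/(77) p.49, Lem. 9.5 p.50 l.11–15 (UNDER ADJUDICATION). [Hironaka2017]
-/

-- `Summit.<Summit>.<Sub>.Theorems` with `Sub = Summit` (single-conjunct summit, D-0017)
set_option linter.dupNamespace false

noncomputable section

namespace Summit.ResolutionOfSingularities.ResolutionOfSingularities.Theorems.CampaignW25.SWReduction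

open MvPowerSeries
open Literature.AlgebraicGeometry.Hironaka2017.S09LLUED
open Literature.AlgebraicGeometry.Hironaka2017.S09LLUED.TopFrontier
open Literature.AlgebraicGeometry.Hironaka2017.S09LLUED.Lem95Coupled
open Literature.AlgebraicGeometry.Hironaka2017.S09LLUED.Lem95CoupledCountermodel
open Literature.AlgebraicGeometry.Hironaka2017.S08UnitMonomial (StandardExpression)
open Literature.AlgebraicGeometry.Hironaka2017.S07Permissible.Cor720Countermodel (𝔽)
open Summit.ResolutionOfSingularities.ResolutionOfSingularities.Theorems.CampaignW25

/-- [OURS · L W2.5 · K2.5] The ray monomial `ω₁^{2^ℓ−2} ω₂³` of SW as an exponent of `𝔽₂⟦x₀, x₁, x₂⟧`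
(`x₀ = y`, `x₁ = ω₁`, `x₂ = ω₂`). REAL definition (bookkeeping). [folklore] -/
def rayMono (ℓ : ℕ) : Fin 3 →₀ ℕ := Finsupp.single 1 (2 ^ ℓ - 2) + Finsupp.single 2 3

/-- Coordinates of `rayMono ℓ`: `(0, 2^ℓ − 2, 3)`. [folklore] -/
theorem rayMono_apply (ℓ : ℕ) : rayMono ℓ 0 = 0 ∧ rayMono ℓ 1 = 2 ^ ℓ - 2 ∧ rayMono ℓ 2 = 3 := by
  have n21 : (2 : Fin 3) ≠ 1 := by decide
  have n12 : (1 : Fin 3) ≠ 2 := by decide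
  have n01 : (0 : Fin 3) ≠ 1 := by decide
  have n02 : (0 : Fin 3) ≠ 2 := by decide
  refine ⟨?_, ?_, ?_⟩
  · simp only [rayMono, Finsupp.add_apply, Finsupp.single_eq_of_ne n01, Finsupp.single_eq_of_ne n02, add_zero]
  · simp only [rayMono, Finsupp.add_apply, Finsupp.single_eq_same, Finsupp.single_eq_of_ne n12, add_zero]
  · simp only [rayMono, Finsupp.add_apply, Finsupp.single_eq_same, Finsupp.single_eq_of_ne n21, zero_add]

/-- The ray monomial has coefficient `1` in `E = toFin εW`. [folklore] -/
theorem coeff_rayMono_E {ℓ : ℕ} (hℓ : 1 ≤ ℓ) : coeff (rayMono ℓ) (toFin 𝔽 2 εW) = 1 := by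
  obtain ⟨h0, h1, h2⟩ := rayMono_apply ℓ
  have hpow : 2 ^ ℓ = 2 * 2 ^ (ℓ - 1) := by rw [← pow_succ', Nat.sub_add_cancel hℓ]
  rw [coeff_E, h0, h1, h2, if_pos ⟨rfl, ⟨2 ^ (ℓ - 1) - 1, by omega⟩, rfl⟩]

/-! ## §1 The MODEL-FREE core: one non-zero ray coefficient forces the bad top-block term -/

section Core

variable {ℓ : ℕ} {ε' : MvPowerSeries (Fin 3) 𝔽} (X : StandardExpression 2 MvPowerSeries.X 1 ℓ ε')

/-- **The forced term (model-free).** If the ray monomial `ω₁^{2^ℓ−2} ω₂³` has a non-zero coefficient in `ε′`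
(`ℓ ≥ 2`), then every depth-`ℓ` standard expression of `ε′` has the effective term `(e₂, 0, (0, 2^{ℓ−1} − 1, 1))`
(digit arithmetic on the covering relation `m = a + 2c + 2^ℓ k`, `a_i < 2`). [cite: Hironaka2017, Eq. (76)/(77) p.49] -/
theorem exists_forced_term (hℓ : 2 ≤ ℓ) (hm : coeff (rayMono ℓ) ε' ≠ 0) :
    ∃ t ∈ effSupport X.support X.u, t.1 = Finsupp.single 2 1 ∧ t.2.1 = 0 ∧
      t.2.2 0 = 0 ∧ t.2.2 1 = 2 ^ (ℓ - 1) - 1 ∧ t.2.2 2 = 1 := by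
  have hpow : 2 ^ ℓ = 2 * 2 ^ (ℓ - 1) := by
    rw [← pow_succ', Nat.sub_add_cancel (by omega : 1 ≤ ℓ)]
  have hP : 2 ≤ 2 ^ (ℓ - 1) := by
    calc 2 = 2 ^ 1 := by norm_num
      _ ≤ 2 ^ (ℓ - 1) := Nat.pow_le_pow_right (by norm_num) (by omega)
  obtain ⟨h0, h1, h2⟩ := rayMono_apply ℓ
  obtain ⟨t, ht, k, hk⟩ := exists_mem_effSupport_of_coeff_ne_zero' X hm
  have htT : t ∈ X.support := effSupport_subset _ _ ht
  have hb : t.2.1 = 0 := SW.snd_fst_eq_zero X htT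
  have ha : ∀ i, t.1 i < 2 := fun i => X.a_lt t htT i
  rw [hb] at hk
  have hz : ∀ i, ∃ z, 2 ^ ℓ * k i = 2 * z := fun i =>
    Dvd.dvd.mul_right (dvd_pow_self 2 (by omega)) _
  have hki : ∀ i, rayMono ℓ i = t.1 i + 2 * t.2.2 i + 2 ^ ℓ * k i := by
    intro i
    have h := DFunLike.congr_fun hk i
    simpa only [Finsupp.add_apply, Finsupp.smul_apply, smul_eq_mul, Finsupp.coe_zero, Pi.zero_apply,
      mul_zero, add_zero, pow_one] using h
  have e0 := hki 0
  have e1 := hki 1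
  have e2 := hki 2
  rw [h0] at e0
  rw [h1] at e1
  rw [h2] at e2
  obtain ⟨z0, hz0⟩ := hz 0
  obtain ⟨z1, hz1⟩ := hz 1
  obtain ⟨z2, hz2⟩ := hz 2
  have ha0 : t.1 0 = 0 := by have := ha 0; omega
  have ha1 : t.1 1 = 0 := by have := ha 1; omega
  have ha2 : t.1 2 = 1 := by have := ha 2; omega
  have hk1 : k 1 = 0 := by
    by_contra hne
    have : 2 ^ ℓ ≤ 2 ^ ℓ * k 1 := Nat.le_mul_of_pos_right _ (Nat.pos_of_ne_zero hne)
    omega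
  have hk2 : k 2 = 0 := by
    by_contra hne
    have : 2 ^ ℓ ≤ 2 ^ ℓ * k 2 := Nat.le_mul_of_pos_right _ (Nat.pos_of_ne_zero hne)
    omega
  rw [hk1, mul_zero, add_zero] at e1
  rw [hk2, mul_zero, add_zero] at e2
  refine ⟨t, ht, ?_, hb, ?_, ?_, ?_⟩
  · ext i
    fin_cases i
    · simpa using ha0
    · simpa using ha1
    · simpa using ha2
  · have : 2 * t.2.2 0 ≤ 2 * t.2.2 0 + 2 ^ ℓ * k 0 := Nat.le_add_right _ _
    omega
  · omega
  · omega

/-- **Condition (i) + the forced term kill condition (ii)** (model-free): if `coeff (rayMono ℓ) ε′ ≠ 0`, `ℓ ≥ 2`, and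
the depth-`ℓ` standard expression `X′` of `ε′` has top pair `(e₂, 0)`, then the forced term is a top-block exponent
`γ_j` with `|qγ_j| = |2 • γ_j| = 2^ℓ`, so `CampaignW25.DerivOrdersBelowDepth 2 1 ℓ X′` is false.
[cite: Hironaka2017, Lem. 9.5 p.50 l.11–14] -/
theorem not_derivOrdersBelowDepth (hℓ : 2 ≤ ℓ) (hm : coeff (rayMono ℓ) ε' ≠ 0)
    (hα : alpha X.support X.u = Finsupp.single 2 1) (hβ : beta X.support X.u = 0) :
    ¬ DerivOrdersBelowDepth 2 1 ℓ X := by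
  obtain ⟨t, ht, ht1, ht2, hc0, hc1, hc2⟩ := exists_forced_term X hℓ hm
  have hkey : toLex t.2.2 ∈ gammaKeys X.support X.u := by
    rw [mem_gammaKeys, ofLex_toLex, hα, hβ]
    have : t = (Finsupp.single 2 1, 0, t.2.2) := Prod.ext ht1 (Prod.ext ht2 rfl)
    rwa [← this]
  obtain ⟨j, hj⟩ := exists_gamma_eq hkey
  have hγ : gamma X.support X.u j = t.2.2 := toLex_inj.1 hj
  rintro ⟨-, hD⟩
  have h := hD j
  rw [hγ, Finsupp.degree_eq_sum, Fin.sum_univ_three] at h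
  simp only [Finsupp.smul_apply, smul_eq_mul, pow_one, hc0, hc1, hc2] at h
  have hpow : 2 ^ ℓ = 2 * 2 ^ (ℓ - 1) := by
    rw [← pow_succ', Nat.sub_add_cancel (by omega : 1 ≤ ℓ)]
  have hP : 1 ≤ 2 ^ (ℓ - 1) := Nat.one_le_two_pow
  omega

end Core

/-! ## §2 On SW the typer's `M_<` cannot touch the ray monomial -/

/-- Nothing is `<lex 0` on `ℕ³`. [folklore] -/
private theorem not_toLex_lt_zero (f : Fin 3 →₀ ℕ) : ¬ toLex f < toLex (0 : Fin 3 →₀ ℕ) :=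
  not_lt.2 (Finsupp.toLex_monotone (by intro i; simp))

section SW

variable {ℓ : ℕ} (X : StandardExpression 2 MvPowerSeries.X 1 ℓ (toFin 𝔽 2 εW))

/-- `e₂ = (0, 0, 1)` is a ray member of SW: `coeff (e₂ + 2·e₂) E = coeff ω₂³ = 1`. [folklore] -/
theorem single_mem_rayOf (hℓ : 1 ≤ ℓ) : Finsupp.single (2 : Fin 3) 1 ∈ rayOf X := by
  show coeff _ _ ≠ 0
  rw [Lem95CoupledCountermodel.alpha_eq rfl X hℓ, Lem95CoupledCountermodel.beta_eq rfl X hℓ, coeff_E]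
  have n20 : (0 : Fin 3) ≠ 2 := by decide
  have n21 : (1 : Fin 3) ≠ 2 := by decide
  rw [if_pos]
  · exact one_ne_zero
  · simp [Finsupp.single_eq_of_ne n20, Finsupp.single_eq_of_ne n21]

/-- **The typer's `M_<` on SW misses the ray monomial**: for `ℓ ≥ 2`, every `f` in
`CampaignW25.MemBelowSpan 2 1 ℓ (α(X)) (β(X)) (rayOf X)` has `coeff (rayMono ℓ) f = 0` — a generator of digit pair
`<lex (e₂, 0)` has `a = 0` (all exponents even), a same-pair generator below the whole ray has `c = 0` (exponent
`e₂ + 2^ℓ κ`, `ω₂`-exponent `≡ 1 (mod 2^ℓ)`); the ray monomial has `ω₂`-exponent `3`.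
[cite: Hironaka2017, Eq. (79)/(80) p.52] -/
theorem coeff_rayMono_eq_zero_of_memBelowSpan (hℓ : 2 ≤ ℓ) {f : MvPowerSeries (Fin 3) 𝔽}
    (hf : MemBelowSpan 2 1 ℓ (alpha X.support X.u) (beta X.support X.u) (rayOf X) f) :
    coeff (rayMono ℓ) f = 0 := by
  classical
  have hpow : 2 ^ ℓ = 2 * 2 ^ (ℓ - 1) := by
    rw [← pow_succ', Nat.sub_add_cancel (by omega : 1 ≤ ℓ)]
  have hP : 2 ≤ 2 ^ (ℓ - 1) := by
    calc 2 = 2 ^ 1 := by norm_num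
      _ ≤ 2 ^ (ℓ - 1) := Nat.pow_le_pow_right (by norm_num) (by omega)
  have hray : Finsupp.single (2 : Fin 3) 1 ∈ rayOf X := single_mem_rayOf X (by omega)
  obtain ⟨T, s, hT, rfl⟩ := hf
  rw [Lem95CoupledCountermodel.alpha_eq rfl X (by omega), Lem95CoupledCountermodel.beta_eq rfl X (by omega)] at hT
  rw [map_sum]
  refine Finset.sum_eq_zero fun t ht => ?_
  obtain ⟨ha, hb, hbelow, hs⟩ := hT t ht
  have hb0 : t.2.1 = 0 := by
    ext j
    have h := hb j
    simp only [Nat.sub_self, pow_zero, Nat.lt_one_iff] at h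
    rw [h, Finsupp.zero_apply]
  by_contra hne
  rw [mono_X_eq_monomial, mul_comm] at hne
  obtain ⟨k, hk⟩ := exists_eq_add_smul_of_coeff_ne_zero (isSupportedOnMultiples_of_mem_frobPow 2 hs) hne
  have e2 : 3 = t.1 2 + 2 * t.2.2 2 + 2 ^ ℓ * k 2 := by
    have h := DFunLike.congr_fun hk 2
    rw [(rayMono_apply ℓ).2.2, hb0] at h
    simpa only [Finsupp.add_apply, Finsupp.smul_apply, smul_eq_mul, Finsupp.coe_zero, Pi.zero_apply,
      mul_zero, add_zero, pow_one] using h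
  obtain ⟨z2, hz2⟩ : ∃ z, 2 ^ ℓ * k 2 = 2 * z := Dvd.dvd.mul_right (dvd_pow_self 2 (by omega)) _
  rcases hbelow with hlt | ⟨h1, -, hall⟩
  · -- digit pair strictly below `(e₂, 0)`: `a = 0`, so every exponent of the generator is even
    have ha0 : t.1 = 0 := by
      unfold pairKey at hlt
      rw [Prod.Lex.toLex_lt_toLex] at hlt
      rcases hlt with h | ⟨-, h⟩
      · exact (SW.toLex_lt_single_two_iff t.1).1 h
      · exact absurd h (not_toLex_lt_zero _)
    rw [ha0, Finsupp.coe_zero, Pi.zero_apply, zero_add] at e2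
    omega
  · -- same pair, third digit below EVERY ray member, in particular below `e₂`: `c = 0`, exponent `e₂ + 2^ℓ k`
    have hc0 : t.2.2 = 0 := (SW.toLex_lt_single_two_iff t.2.2).1 (hall _ hray)
    rw [h1, hc0, Finsupp.single_eq_same, Finsupp.coe_zero, Pi.zero_apply, mul_zero, add_zero] at e2
    have hk2 : k 2 ≠ 0 := by
      intro h0
      rw [h0, mul_zero] at e2
      omega
    have : 2 ^ ℓ ≤ 2 ^ ℓ * k 2 := Nat.le_mul_of_pos_right _ (Nat.pos_of_ne_zero hk2)
    omega

/-! ## §3 BY NAME: `CampaignW25.K25Reduction 2 1 ℓ E` fails at every standard expression of `E` -/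

/-- **K2.5 against the typer's decl, pointwise.** For every depth-`ℓ` standard expression `X` of `E = toFin εW`
(`ℓ ≥ 2`), the clause of `CampaignW25.K25Reduction` at `X` is FALSE: no `ε′`, `X′` with (i) the same `(α, β)`,
(ii) finite ray and `DerivOrdersBelowDepth`, (iii) `E − ε′ ∈ M_<(X)`. [cite: Hironaka2017, Lem. 9.5 p.50 l.11–14] -/
theorem k25Reduction_fails_at (hℓ : 2 ≤ ℓ) :
    ¬ ∃ (ε' : MvPowerSeries (Fin 3) 𝔽)
        (X' : StandardExpression 2 (MvPowerSeries.X : Fin 3 → MvPowerSeries (Fin 3) 𝔽) 1 ℓ ε'),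
        alpha X'.support X'.u = alpha X.support X.u ∧ beta X'.support X'.u = beta X.support X.u ∧
          (rayOf X').Finite ∧ DerivOrdersBelowDepth 2 1 ℓ X' ∧
            MemBelowSpan 2 1 ℓ (alpha X.support X.u) (beta X.support X.u) (rayOf X) (toFin 𝔽 2 εW - ε') := by
  rintro ⟨ε', X', hα, hβ, -, hD, hM⟩
  have hαE := Lem95CoupledCountermodel.alpha_eq rfl X (by omega : 1 ≤ ℓ)
  have hβE := Lem95CoupledCountermodel.beta_eq rfl X (by omega : 1 ≤ ℓ)
  have hzero := coeff_rayMono_eq_zero_of_memBelowSpan X hℓ hM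
  have hm : coeff (rayMono ℓ) ε' ≠ 0 := by
    rw [map_sub, coeff_rayMono_E (by omega : 1 ≤ ℓ), sub_eq_zero] at hzero
    rw [← hzero]
    exact one_ne_zero
  exact not_derivOrdersBelowDepth X' hℓ hm (hα.trans hαE) (hβ.trans hβE) hD

end SW

/-- **K2.5 against the typer's decl** (hypothesis form). For `ℓ ≥ 2`, `CampaignW25.K25Reduction 2 1 ℓ E` is FALSE on SW
as soon as `E` has one standard expression of depth `ℓ`; `not_K25Reduction'` below discharges that hypothesis with
`SW.stdExprSW`. [cite: Hironaka2017, Lem. 9.5 p.50 l.11–14] -/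
theorem not_K25Reduction {ℓ : ℕ} (hℓ : 2 ≤ ℓ)
    (hX : Nonempty (StandardExpression 2 (MvPowerSeries.X : Fin 3 → MvPowerSeries (Fin 3) 𝔽) 1 ℓ (toFin 𝔽 2 εW))) :
    ¬ K25Reduction 2 1 ℓ (toFin 𝔽 2 εW) := fun h =>
  hX.elim fun X => k25Reduction_fails_at X hℓ (h X)

/-- **K2.5 against the typer's decl, UNCONDITIONAL** (`ℓ ≥ 2`): the standard expression of `E` of depth `ℓ` exists
(`SW.stdExprSW`, `MarkedTransferCampaignW25SWStdExpr.lean`), so `CampaignW25.K25Reduction 2 1 ℓ E` is false on SW.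
[cite: Hironaka2017, Lem. 9.5 p.50 l.11–14] -/
theorem not_K25Reduction' {ℓ : ℕ} (hℓ : 2 ≤ ℓ) : ¬ K25Reduction 2 1 ℓ (toFin 𝔽 2 εW) :=
  not_K25Reduction hℓ (SW.nonempty_stdExpr (by omega))

/-- T1 by name (`ℓ = 3`), unconditional. [cite: Hironaka2017, Lem. 9.5 p.50 l.11–14] -/
theorem not_K25Reduction_three : ¬ K25Reduction 2 1 3 (toFin 𝔽 2 εW) := not_K25Reduction' (by norm_num)

/-- T2 by name (`ℓ = 4`), unconditional. [cite: Hironaka2017, Lem. 9.5 p.50 l.11–14] -/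
theorem not_K25Reduction_four : ¬ K25Reduction 2 1 4 (toFin 𝔽 2 εW) := not_K25Reduction' (by norm_num)

end Summit.ResolutionOfSingularities.ResolutionOfSingularities.Theorems.CampaignW25.SWReduction

end
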